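import Summits.AtomisticToContinuum.FouriersLaw.Theorems.HiddenChargeMazurOddChargeAlgebraNormalForm

/-!
# Odd conservation laws of the pinned anharmonic chain — normal form vs. gradings, class projections

Second half of the normal-form toolkit: the left-aligned normal form `N = nf` commutes with the
weighted homogeneous components of the translation-invariant weights `wt`, `pwt` and with momentum
reversal `rev`; the class projections `projSD s e` (span `s`, momentum degree `e`) are orthogonal
idempotents with explicit coefficients; vanishing criteria for `projSD s e (N T)` by site range and
by momentum degree. [folklore]
-/

noncomputable section

open MvPolynomial Finsupp
open scoped BigOperators

namespace Summit.AtomisticToContinuum.FouriersLaw.Theorems.OddChargeAlgebra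

/-- `liftMon φ f` as a sum over the support of `f`. [folklore] -/
theorem liftMon_apply (φ : (Var →₀ ℕ) → R) (f : R) :
    liftMon φ f = ∑ m ∈ f.support, f.coeff m • φ m := by
  conv_lhs => rw [f.as_sum]
  rw [map_sum]
  exact Finset.sum_congr rfl fun m _ => by rw [liftMon_monomial]

/-! ## `N` and the gradings, momentum reversal -/

/-- A weighted homogeneous component of a monomial. [folklore] -/
theorem weightedHomogeneousComponent_monomial {w : Var → ℕ} (n : ℕ) (m : Var →₀ ℕ) (c : ℝ) :
    weightedHomogeneousComponent w n (monomial m c) =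
      if n = weight w m then monomial m c else 0 := by
  classical
  exact weightedHomogeneousComponent_of_mem
    ((mem_weightedHomogeneousSubmodule _ _ _ _).mpr (isWeightedHomogeneous_monomial w m c rfl))

/-- (C₅) `N` commutes with the weighted homogeneous components of any translation-invariant
weight. [folklore] -/
theorem nf_weightedHomogeneousComponent {w : Var → ℕ} (hw : ∀ (k : ℤ) (v : Var), w (transl k v) = w v)
    (n : ℕ) (f : R) :
    nf (weightedHomogeneousComponent w n f) = weightedHomogeneousComponent w n (nf f) := by
  induction f using MvPolynomial.induction_on' with
  | monomial m c =>
    rw [weightedHomogeneousComponent_monomial, nf_monomial, weightedHomogeneousComponent_monomial,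
      nfMon, weight_mapDomain_transl (hw _)]
    split_ifs
    · rw [nf_monomial, nfMon]
    · rw [map_zero]
  | add p q hp hq => rw [map_add, map_add, hp, hq, map_add, map_add]

/-- (C₅) `N` commutes with the `wt`-homogeneous components. [folklore] -/
theorem nf_weightedHomogeneousComponent_wt (n : ℕ) (f : R) :
    nf (weightedHomogeneousComponent wt n f) = weightedHomogeneousComponent wt n (nf f) :=
  nf_weightedHomogeneousComponent wt_transl n f

/-- (C₅) `N` commutes with the `pwt`-homogeneous components. [folklore] -/
theorem nf_weightedHomogeneousComponent_pwt (n : ℕ) (f : R) :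
    nf (weightedHomogeneousComponent pwt n f) = weightedHomogeneousComponent pwt n (nf f) :=
  nf_weightedHomogeneousComponent pwt_transl n f

/-- (C₅) `N` preserves weighted homogeneity (translation-invariant weight). [folklore] -/
theorem isWeightedHomogeneous_nf {w : Var → ℕ} (hw : ∀ (k : ℤ) (v : Var), w (transl k v) = w v)
    {f : R} {n : ℕ} (h : IsWeightedHomogeneous w f n) : IsWeightedHomogeneous w (nf f) n := by
  rw [← weightedHomogeneousComponent_eq_self h, nf_weightedHomogeneousComponent hw]
  exact weightedHomogeneousComponent_isWeightedHomogeneous n _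

/-- (C₅) `N` preserves `wt`-homogeneity. [folklore] -/
theorem isWeightedHomogeneous_wt_nf {f : R} {n : ℕ} (h : IsWeightedHomogeneous wt f n) :
    IsWeightedHomogeneous wt (nf f) n :=
  isWeightedHomogeneous_nf wt_transl h

/-- (C₅) `N` preserves `pwt`-homogeneity. [folklore] -/
theorem isWeightedHomogeneous_pwt_nf {f : R} {n : ℕ} (h : IsWeightedHomogeneous pwt f n) :
    IsWeightedHomogeneous pwt (nf f) n :=
  isWeightedHomogeneous_nf pwt_transl h

/-- Momentum reversal on a monomial: the sign `(-1)^(momentum degree)`. [folklore] -/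
theorem rev_monomial (m : Var →₀ ℕ) (c : ℝ) :
    rev (monomial m c) = C ((-1 : ℝ) ^ weight pwt m) * monomial m c := by
  have hg : ∀ v : Var, (Sum.elim (fun x => X (Sum.inl x)) (fun x => -X (Sum.inr x)) v : R) =
      C ((-1 : ℝ) ^ pwt v) * X v := by
    intro v; cases v <;> simp [pwt]
  simp only [rev, aeval_monomial, algebraMap_eq, Finsupp.prod, hg, mul_pow, Finset.prod_mul_distrib,
    ← map_pow, ← map_prod, ← pow_mul, Finset.prod_pow_eq_pow_sum]
  rw [prod_X_pow_eq_monomial, weight_apply, Finsupp.sum, C_mul_monomial, C_mul_monomial,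
    C_mul_monomial, mul_one]
  congr 1
  rw [mul_comm]
  congr 2
  exact Finset.sum_congr rfl fun v _ => by rw [smul_eq_mul, mul_comm]

/-- (C₅) `N` commutes with momentum reversal. [folklore] -/
theorem rev_nf : ∀ f : R, rev (nf f) = nf (rev f) := by
  intro f
  induction f using MvPolynomial.induction_on' with
  | monomial m c =>
    rw [nf_monomial, rev_monomial, rev_monomial, weight_pwt_nfMon, C_mul', C_mul', map_smul,
      nf_monomial]
  | add p q hp hq => rw [map_add, map_add, hp, hq, map_add, map_add]

/-! ## The class projections -/

/-- `proj P` on a monomial. [folklore] -/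
theorem proj_monomial (P : (Var →₀ ℕ) → Prop) [DecidablePred P] (m : Var →₀ ℕ) (c : ℝ) :
    proj P (monomial m c) = if P m then monomial m c else 0 := by
  rw [proj, liftMon_monomial]
  split_ifs
  · rw [smul_monomial, smul_eq_mul, mul_one]
  · rw [smul_zero]

/-- `projSD s e` on a monomial. [folklore] -/
theorem projSD_monomial (s : ℤ) (e : ℕ) (m : Var →₀ ℕ) (c : ℝ) :
    projSD s e (monomial m c) =
      if minsite m = 0 ∧ maxsite m = s ∧ weight pwt m = e then monomial m c else 0 :=
  proj_monomial _ m c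

/-- The coefficients of `projSD s e f`. [folklore] -/
theorem coeff_projSD (s : ℤ) (e : ℕ) (f : R) (n : Var →₀ ℕ) :
    (projSD s e f).coeff n =
      if minsite n = 0 ∧ maxsite n = s ∧ weight pwt n = e then f.coeff n else 0 := by
  classical
  induction f using MvPolynomial.induction_on' with
  | monomial m c =>
    rw [projSD_monomial]
    by_cases h : n = m
    · subst h
      split_ifs <;> simp
    · simp only [coeff_monomial, Ne.symm h, if_false]
      split_ifs <;> simp [coeff_monomial, Ne.symm h]
  | add p q hp hq =>
    rw [map_add, coeff_add, hp, hq, coeff_add]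
    split_ifs <;> ring

/-- The support of `projSD s e f`. [folklore] -/
theorem mem_support_projSD_iff {s : ℤ} {e : ℕ} {f : R} {n : Var →₀ ℕ} :
    n ∈ (projSD s e f).support ↔
      n ∈ f.support ∧ (minsite n = 0 ∧ maxsite n = s ∧ weight pwt n = e) := by
  rw [MvPolynomial.mem_support_iff, MvPolynomial.mem_support_iff, coeff_projSD]
  split_ifs with h <;> simp [h]

/-- A polynomial of pure class `(s, e)` is fixed by `projSD s e`. [folklore] -/
theorem projSD_eq_self {s : ℤ} {e : ℕ} {f : R}
    (h : ∀ m ∈ f.support, minsite m = 0 ∧ maxsite m = s ∧ weight pwt m = e) : projSD s e f = f := by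
  ext n
  rw [coeff_projSD]
  split_ifs with hn
  · rfl
  · by_contra h'
    exact hn (h n (MvPolynomial.mem_support_iff.mpr (Ne.symm h')))

/-- A polynomial without monomials of class `(s, e)` is killed by `projSD s e`. [folklore] -/
theorem projSD_eq_zero {s : ℤ} {e : ℕ} {f : R}
    (h : ∀ m ∈ f.support, ¬(minsite m = 0 ∧ maxsite m = s ∧ weight pwt m = e)) :
    projSD s e f = 0 := by
  ext n
  rw [coeff_projSD, coeff_zero]
  split_ifs with hn
  · by_contra h'
    exact h n (MvPolynomial.mem_support_iff.mpr h') hn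
  · rfl

/-- The class projections are orthogonal idempotents. [folklore] -/
theorem projSD_projSD (s : ℤ) (e : ℕ) (s' : ℤ) (e' : ℕ) (f : R) :
    projSD s e (projSD s' e' f) = if s = s' ∧ e = e' then projSD s e f else 0 := by
  ext n
  split_ifs with h
  · obtain ⟨rfl, rfl⟩ := h
    rw [coeff_projSD, coeff_projSD]
    split_ifs <;> rfl
  · rw [coeff_projSD, coeff_projSD, coeff_zero]
    split_ifs with h1 h2
    · exact absurd ⟨h1.2.1.symm.trans h2.2.1, h1.2.2.symm.trans h2.2.2⟩ h
    · rfl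
    · rfl

/-- `projSD` of an `N`-invariant polynomial only sees `maxsite` and the momentum degree. [folklore] -/
theorem coeff_projSD_of_nf_eq_self {f : R} (hf : nf f = f) (s : ℤ) (e : ℕ) (n : Var →₀ ℕ) :
    (projSD s e f).coeff n = if maxsite n = s ∧ weight pwt n = e then f.coeff n else 0 := by
  rw [coeff_projSD]
  by_cases hn : n ∈ f.support
  · have h0 : minsite n = 0 := by
      rcases nf_eq_self_iff.mp hf n hn with rfl | h
      · exact minsite_zero
      · exact h
    simp [h0]
  · rw [MvPolynomial.notMem_support_iff] at hn
    simp [hn]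

/-- `projSD` of a polynomial all of whose monomials have minimal site `0`, maximal site `s'` and
momentum degree `d - 1` (stated additively). [folklore] -/
theorem projSD_eq_ite_of_succ {T : R} {s' : ℤ} {d : ℕ}
    (h : ∀ n ∈ T.support, minsite n = 0 ∧ maxsite n = s' ∧ weight pwt n + 1 = d) (s : ℤ) (e : ℕ) :
    projSD s e T = if s' = s ∧ d = e + 1 then T else 0 := by
  split_ifs with hc
  · obtain ⟨rfl, rfl⟩ := hc
    exact projSD_eq_self fun n hn => ⟨(h n hn).1, (h n hn).2.1, by have := (h n hn).2.2; omega⟩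
  · refine projSD_eq_zero fun n hn hn' => hc ⟨(h n hn).2.1.symm.trans hn'.2.1, ?_⟩
    have := (h n hn).2.2
    omega

/-- `projSD` of a polynomial of pure class `(s', d')`. [folklore] -/
theorem projSD_eq_ite_of_pure {T : R} {s' : ℤ} {d' : ℕ}
    (h : ∀ n ∈ T.support, minsite n = 0 ∧ maxsite n = s' ∧ weight pwt n = d') (s : ℤ) (e : ℕ) :
    projSD s e T = if s' = s ∧ d' = e then T else 0 := by
  split_ifs with hc
  · obtain ⟨rfl, rfl⟩ := hc
    exact projSD_eq_self h
  · exact projSD_eq_zero fun n hn hn' =>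
      hc ⟨(h n hn).2.1.symm.trans hn'.2.1, (h n hn).2.2.symm.trans hn'.2.2⟩

/-- A polynomial all of whose monomials have minimal site `-k` normalises to its `k`-fold
translate. [folklore] -/
theorem nf_eq_shiftBy_of {f : R} {k : ℤ} (h : ∀ m ∈ f.support, minsite m = -k) :
    nf f = shiftBy k f := by
  rw [nf_apply]
  conv_rhs => rw [f.as_sum, map_sum]
  refine Finset.sum_congr rfl fun m hm => ?_
  rw [shiftBy_monomial, nfMon, h m hm, neg_neg]

/-- `projSD s e (N T) = 0` if the sites of `T` lie in a window of fewer than `s + 1` sites. [folklore] -/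
theorem projSD_nf_eq_zero_of_site_mem {T : R} {a b : ℤ} (hab : a ≤ b)
    (h : ∀ n ∈ T.support, ∀ v ∈ n.support, Var.site v ∈ Set.Icc a b) {s : ℤ} (hs : b - a < s)
    (e : ℕ) : projSD s e (nf T) = 0 := by
  refine projSD_eq_zero fun n hn hc => ?_
  obtain ⟨m, hm, rfl⟩ := Finset.mem_image.mp (support_nf_subset T hn)
  obtain ⟨-, hmax, -⟩ := hc
  by_cases hm0 : m = 0
  · subst hm0
    rw [nfMon_zero, maxsite_zero] at hmax
    omega
  · rw [maxsite_nfMon hm0] at hmax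
    obtain ⟨v, hv, hv'⟩ := exists_site_eq_minsite hm0
    obtain ⟨w, hw, hw'⟩ := exists_site_eq_maxsite hm0
    have h1 := h m hm v hv
    have h2 := h m hm w hw
    simp only [Set.mem_Icc] at h1 h2
    omega

/-- `projSD s e (N T) = 0` if no monomial of `T` has momentum degree `e`. [folklore] -/
theorem projSD_nf_eq_zero_of_weight_ne {T : R} {e : ℕ} (h : ∀ n ∈ T.support, weight pwt n ≠ e)
    (s : ℤ) : projSD s e (nf T) = 0 := by
  refine projSD_eq_zero fun n hn hc => ?_
  obtain ⟨m, hm, rfl⟩ := Finset.mem_image.mp (support_nf_subset T hn)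
  exact h m hm (by rw [← weight_pwt_nfMon]; exact hc.2.2)

/-- `projSD ∘ N` commutes with multiplication by constants. [folklore] -/
theorem projSD_nf_C_mul (s : ℤ) (e : ℕ) (a : ℝ) (T : R) :
    projSD s e (nf (C a * T)) = C a * projSD s e (nf T) := by
  rw [C_mul', map_smul, map_smul, C_mul']

end Summit.AtomisticToContinuum.FouriersLaw.Theorems.OddChargeAlgebra

end
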